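import Mathlib
import Summits.Langlands.Langlands.Theses.NonParallelVoid
import HarnessLib

/-!
# Sketch — first lemmas for the crux ideas `parity-typed-torsion-feed` and
# `odd-central-character-ramification` (crux `TensorSquareParallel`, stmt-Langlands-17009)

Ideator: planner-cruxidea-stmt-Langlands-17009-2-0 (round 1, k = 2).  Statements only (sorried);
they are the FIRST CHECKABLE STATEMENTS of the two lines, typed over the route file's vocabulary.

* `stub_oddGapSum_ramified_away_from_p` (card odd-central-character-ramification): odd gap sum +
  crystalline at the two places above the split prime `p` ⟹ `ρ` is ramified at some finite place
  NOT above `p` (global reciprocity applied to `det ρ` at the unit `-1 ∈ 𝓞_F^×`).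
* `stub_unramifiedOutsideP_void` (same card): the crux `TensorSquareParallel` restricted to `ρ`
  unramified away from `p` — provable now (its hypotheses are contradictory by the previous stub).
* `stub_noParallelCrystallineCompanion` (card parity-typed-torsion-feed): under the crux hypotheses
  no `ρ'` with the same residual determinant as `ρ` is crystalline above `p` with PARALLEL gaps —
  the Galois shadow of "`ρ̄` has no pure Serre weight" (residual determinant parity).
-/

open scoped BigOperators Topology Classical Matrix
open Filter Set Function

namespace Summit.Langlands.Langlands.Cruxes.TensorSquareParallel.ParitySketch

/-- Card `odd-central-character-ramification`, first lemma: odd gap sum forces ramification of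
`det ρ` (hence of `ρ`) at a finite place prime to `p`. -/
theorem stub_oddGapSum_ramified_away_from_p : ∀ (F : Type) [Field F] [NumberField F] [Algebra.IsQuadraticExtension ℚ F], NumberField.IsTotallyComplex F → ∀ (p : ℕ) [Fact p.Prime] (ρ : Literature.NumberTheory.GaloisRepresentations.FramedGaloisRep F (PadicAlgCl p) 2), (∀ (v : IsDedekindDomain.HeightOneSpectrum (NumberField.RingOfIntegers F)) (hv : ((p : ℕ) : NumberField.RingOfIntegers F) ∈ v.asIdeal), (Literature.NumberTheory.PAdicHodge.fontainePstAdicCompletion v p hv).IsDeRhamFramed (ρ.toLocal v) ∧ (letI := (Literature.NumberTheory.PAdicHodge.fontainePstAdicCompletion v p hv).algebra; ∀ τ : v.adicCompletion F →ₐ[ℚ_[p]] PadicAlgCl p, ∃ a b : ℤ, a < b ∧ ρ.labelledHodgeTateWeightsAt v (Literature.NumberTheory.PAdicHodge.fontainePstAdicCompletion v p hv).algebra (Literature.NumberTheory.PAdicHodge.fontainePstAdicCompletion v p hv).𝔅 τ.toRingHom = {a, b})) → (11 ≤ p ∧ (∃ v w : IsDedekindDomain.HeightOneSpectrum (NumberField.RingOfIntegers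 F), v ≠ w ∧ ((p : ℕ) : NumberField.RingOfIntegers F) ∈ v.asIdeal ∧ ((p : ℕ) : NumberField.RingOfIntegers F) ∈ w.asIdeal) ∧ (∀ (v : IsDedekindDomain.HeightOneSpectrum (NumberField.RingOfIntegers F)) (hv : ((p : ℕ) : NumberField.RingOfIntegers F) ∈ v.asIdeal), (Literature.NumberTheory.PAdicHodge.fontainePstAdicCompletion v p hv).IsCrystallineFramed (ρ.toLocal v)) ∧ Literature.NumberTheory.GaloisRepresentations.FramedGaloisRep.IsResiduallyAbsIrreducible (ρ.restrictField (CyclotomicField p F))) → ¬ (∀ (v : IsDedekindDomain.HeightOneSpectrum (NumberField.RingOfIntegers F)) (hv : ((p : ℕ) : NumberField.RingOfIntegers F) ∈ v.asIdeal) (w : IsDedekindDomain.HeightOneSpectrum (NumberField.RingOfIntegers F)) (hw : ((p : ℕ) : NumberField.RingOfIntegers F) ∈ w.asIdeal), letI := (Literature.NumberTheory.PAdicHodge.fontainePstAdicCompletion v p hv).algebra; letI := (Literature.NumberTheory.PAdicHodge.fontainePstAdicCompletion w p hw).algebra; ∀ (τ : v.adicCompletion F →ₐ[ℚ_[p]]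 PadicAlgCl p) (σ : w.adicCompletion F →ₐ[ℚ_[p]] PadicAlgCl p) (a b a' b' : ℤ), ρ.labelledHodgeTateWeightsAt v (Literature.NumberTheory.PAdicHodge.fontainePstAdicCompletion v p hv).algebra (Literature.NumberTheory.PAdicHodge.fontainePstAdicCompletion v p hv).𝔅 τ.toRingHom = {a, b} → a < b → ρ.labelledHodgeTateWeightsAt w (Literature.NumberTheory.PAdicHodge.fontainePstAdicCompletion w p hw).algebra (Literature.NumberTheory.PAdicHodge.fontainePstAdicCompletion w p hw).𝔅 σ.toRingHom = {a', b'} → a' < b' → Even (b - a + (b' - a'))) →  ¬ (∀ v : IsDedekindDomain.HeightOneSpectrum (NumberField.RingOfIntegers F), ((p : ℕ) : NumberField.RingOfIntegers F) ∉ v.asIdeal → ρ.IsUnramifiedAt v) := by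
  sorry

/-- Card `odd-central-character-ramification`: the crux for `ρ` unramified away from `p` (all sectors,
all weights, all residual images) — hypotheses contradictory by `stub_oddGapSum_ramified_away_from_p`. -/
theorem stub_unramifiedOutsideP_void : ∀ (F : Type) [Field F] [NumberField F] [Algebra.IsQuadraticExtension ℚ F], NumberField.IsTotallyComplex F → ∀ (p : ℕ) [Fact p.Prime] (ρ : Literature.NumberTheory.GaloisRepresentations.FramedGaloisRep F (PadicAlgCl p) 2), ρ.toGaloisRep.IsIrreducible → (∀ᶠ v : IsDedekindDomain.HeightOneSpectrum (NumberField.RingOfIntegers F) in Filter.cofinite, ρ.IsUnramifiedAt v) → (∀ (v : IsDedekindDomain.HeightOneSpectrum (NumberField.RingOfIntegers F)) (hv : ((p : ℕ) : NumberField.RingOfIntegers F) ∈ v.asIdeal), (Literature.NumberTheory.PAdicHodge.fontainePstAdicCompletion v p hv).IsDeRhamFramed (ρ.toLocal v) ∧ (letI := (Literature.NumberTheory.PAdicHodge.fontainePstAdicCompletion v p hv).algebra; ∀ τ : v.adicCompletion F →ₐ[ℚ_[p]] PadicAlgCl p, ∃ a b : ℤ, a < b ∧ ρ.labelledHodgeTateWeightsAt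 v (Literature.NumberTheory.PAdicHodge.fontainePstAdicCompletion v p hv).algebra (Literature.NumberTheory.PAdicHodge.fontainePstAdicCompletion v p hv).𝔅 τ.toRingHom = {a, b})) → (11 ≤ p ∧ (∃ v w : IsDedekindDomain.HeightOneSpectrum (NumberField.RingOfIntegers F), v ≠ w ∧ ((p : ℕ) : NumberField.RingOfIntegers F) ∈ v.asIdeal ∧ ((p : ℕ) : NumberField.RingOfIntegers F) ∈ w.asIdeal) ∧ (∀ (v : IsDedekindDomain.HeightOneSpectrum (NumberField.RingOfIntegers F)) (hv : ((p : ℕ) : NumberField.RingOfIntegers F) ∈ v.asIdeal), (Literature.NumberTheory.PAdicHodge.fontainePstAdicCompletion v p hv).IsCrystallineFramed (ρ.toLocal v)) ∧ Literature.NumberTheory.GaloisRepresentations.FramedGaloisRep.IsResiduallyAbsIrreducible (ρ.restrictField (CyclotomicField p F))) → ¬ (∀ (v : IsDedekindDomain.HeightOneSpectrum (NumberField.RingOfIntegers F)) (hv : ((p : ℕ) : NumberField.RingOfIntegers F) ∈ v.asIdeal) (w : IsDedekindDomain.HeightOneSpectrum (NumberField.RingOfIntegers F)) (hw : ((p : ℕ)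 : NumberField.RingOfIntegers F) ∈ w.asIdeal), letI := (Literature.NumberTheory.PAdicHodge.fontainePstAdicCompletion v p hv).algebra; letI := (Literature.NumberTheory.PAdicHodge.fontainePstAdicCompletion w p hw).algebra; ∀ (τ : v.adicCompletion F →ₐ[ℚ_[p]] PadicAlgCl p) (σ : w.adicCompletion F →ₐ[ℚ_[p]] PadicAlgCl p) (a b a' b' : ℤ), ρ.labelledHodgeTateWeightsAt v (Literature.NumberTheory.PAdicHodge.fontainePstAdicCompletion v p hv).algebra (Literature.NumberTheory.PAdicHodge.fontainePstAdicCompletion v p hv).𝔅 τ.toRingHom = {a, b} → a < b → ρ.labelledHodgeTateWeightsAt w (Literature.NumberTheory.PAdicHodge.fontainePstAdicCompletion w p hw).algebra (Literature.NumberTheory.PAdicHodge.fontainePstAdicCompletion w p hw).𝔅 σ.toRingHom = {a', b'} → a' < b' → Even (b - a + (b' - a'))) → ¬ (∃ τ : Field.absoluteGaloisGroup ℚ, τ ∉ Set.range (Literature.NumberTheory.GaloisRepresentations.absGaloisRestrict ℚ F) ∧ ∃ χ : Field.absoluteGaloisGroup F →* (Literature.NumberTheory.GaloisRepresentations.padicAlgClResidueField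 p)ˣ, ∀ σ σ' : Field.absoluteGaloisGroup F, Literature.NumberTheory.GaloisRepresentations.absGaloisRestrict ℚ F σ' = τ * Literature.NumberTheory.GaloisRepresentations.absGaloisRestrict ℚ F σ * τ⁻¹ → (ρ.residualRep σ').val.trace = (χ σ : Literature.NumberTheory.GaloisRepresentations.padicAlgClResidueField p) * (ρ.residualRep σ).val.trace ∧ (ρ.residualRep σ').val.det = (χ σ : Literature.NumberTheory.GaloisRepresentations.padicAlgClResidueField p) ^ 2 * (ρ.residualRep σ).val.det)  → (∀ v : IsDedekindDomain.HeightOneSpectrum (NumberField.RingOfIntegers F), ((p : ℕ) : NumberField.RingOfIntegers F) ∉ v.asIdeal → ρ.IsUnramifiedAt v) → ∃ g : ℤ, ∀ (v : IsDedekindDomain.HeightOneSpectrum (NumberField.RingOfIntegers F)) (hv : ((p : ℕ) : NumberField.RingOfIntegers F) ∈ v.asIdeal), letI := (Literature.NumberTheory.PAdicHodge.fontainePstAdicCompletion v p hv).algebra; ∀ τ : v.adicCompletion F →ₐ[ℚ_[p]] PadicAlgCl p, ∃ a : ℤ, ρ.labelledHodgeTateWeightsAt v (Literature.NumberTheory.PAdicHodge.fontainePstAdicCompletion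 v p hv).algebra (Literature.NumberTheory.PAdicHodge.fontainePstAdicCompletion v p hv).𝔅 τ.toRingHom = {a, a + g} := by
  sorry

/-- Card `parity-typed-torsion-feed`, first lemma: no crystalline `ρ'` with parallel gaps shares the
residual determinant of `ρ` (odd gap sum ⟹ inertial `det ρ̄`-exponents of opposite parity at the two
places above `p`; parallel gaps ⟹ equal parity). -/
theorem stub_noParallelCrystallineCompanion : ∀ (F : Type) [Field F] [NumberField F] [Algebra.IsQuadraticExtension ℚ F], NumberField.IsTotallyComplex F → ∀ (p : ℕ) [Fact p.Prime] (ρ : Literature.NumberTheory.GaloisRepresentations.FramedGaloisRep F (PadicAlgCl p) 2), (∀ (v : IsDedekindDomain.HeightOneSpectrum (NumberField.RingOfIntegers F)) (hv : ((p : ℕ) : NumberField.RingOfIntegers F) ∈ v.asIdeal), (Literature.NumberTheory.PAdicHodge.fontainePstAdicCompletion v p hv).IsDeRhamFramed (ρ.toLocal v) ∧ (letI := (Literature.NumberTheory.PAdicHodge.fontainePstAdicCompletion v p hv).algebra; ∀ τ : v.adicCompletion F →ₐ[ℚ_[p]] PadicAlgCl p, ∃ a b : ℤ, a < b ∧ ρ.labelledHodgeTateWeightsAt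 v (Literature.NumberTheory.PAdicHodge.fontainePstAdicCompletion v p hv).algebra (Literature.NumberTheory.PAdicHodge.fontainePstAdicCompletion v p hv).𝔅 τ.toRingHom = {a, b})) → (11 ≤ p ∧ (∃ v w : IsDedekindDomain.HeightOneSpectrum (NumberField.RingOfIntegers F), v ≠ w ∧ ((p : ℕ) : NumberField.RingOfIntegers F) ∈ v.asIdeal ∧ ((p : ℕ) : NumberField.RingOfIntegers F) ∈ w.asIdeal) ∧ (∀ (v : IsDedekindDomain.HeightOneSpectrum (NumberField.RingOfIntegers F)) (hv : ((p : ℕ) : NumberField.RingOfIntegers F) ∈ v.asIdeal), (Literature.NumberTheory.PAdicHodge.fontainePstAdicCompletion v p hv).IsCrystallineFramed (ρ.toLocal v)) ∧ Literature.NumberTheory.GaloisRepresentations.FramedGaloisRep.IsResiduallyAbsIrreducible (ρ.restrictField (CyclotomicField p F))) → ¬ (∀ (v : IsDedekindDomain.HeightOneSpectrum (NumberField.RingOfIntegers F)) (hv : ((p : ℕ) : NumberField.RingOfIntegers F) ∈ v.asIdeal) (w : IsDedekindDomain.HeightOneSpectrum (NumberField.RingOfIntegers F)) (hw : ((p : ℕ)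 : NumberField.RingOfIntegers F) ∈ w.asIdeal), letI := (Literature.NumberTheory.PAdicHodge.fontainePstAdicCompletion v p hv).algebra; letI := (Literature.NumberTheory.PAdicHodge.fontainePstAdicCompletion w p hw).algebra; ∀ (τ : v.adicCompletion F →ₐ[ℚ_[p]] PadicAlgCl p) (σ : w.adicCompletion F →ₐ[ℚ_[p]] PadicAlgCl p) (a b a' b' : ℤ), ρ.labelledHodgeTateWeightsAt v (Literature.NumberTheory.PAdicHodge.fontainePstAdicCompletion v p hv).algebra (Literature.NumberTheory.PAdicHodge.fontainePstAdicCompletion v p hv).𝔅 τ.toRingHom = {a, b} → a < b → ρ.labelledHodgeTateWeightsAt w (Literature.NumberTheory.PAdicHodge.fontainePstAdicCompletion w p hw).algebra (Literature.NumberTheory.PAdicHodge.fontainePstAdicCompletion w p hw).𝔅 σ.toRingHom = {a', b'} → a' < b' → Even (b - a + (b' - a'))) →  ∀ ρ' : Literature.NumberTheory.GaloisRepresentations.FramedGaloisRep F (PadicAlgCl p) 2, (∀ σ : Field.absoluteGaloisGroup F, (ρ'.residualRep σ).val.det = (ρ.residualRep σ).val.det) → (∀ (v : IsDedekindDomain.HeightOneSpectrum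 (NumberField.RingOfIntegers F)) (hv : ((p : ℕ) : NumberField.RingOfIntegers F) ∈ v.asIdeal), (Literature.NumberTheory.PAdicHodge.fontainePstAdicCompletion v p hv).IsCrystallineFramed (ρ'.toLocal v)) → (∃ g : ℤ, ∀ (v : IsDedekindDomain.HeightOneSpectrum (NumberField.RingOfIntegers F)) (hv : ((p : ℕ) : NumberField.RingOfIntegers F) ∈ v.asIdeal), letI := (Literature.NumberTheory.PAdicHodge.fontainePstAdicCompletion v p hv).algebra; ∀ τ : v.adicCompletion F →ₐ[ℚ_[p]] PadicAlgCl p, ∃ a : ℤ, ρ'.labelledHodgeTateWeightsAt v (Literature.NumberTheory.PAdicHodge.fontainePstAdicCompletion v p hv).algebra (Literature.NumberTheory.PAdicHodge.fontainePstAdicCompletion v p hv).𝔅 τ.toRingHom = {a, a + g}) → False := by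
  sorry

/-- Read-back: the unramified-away-from-`p` case is literally an instance of the crux. -/
theorem unramifiedOutsideP_void_of_crux
    (h : Summit.Langlands.Langlands.Theses.NonParallelVoid.TensorSquareParallel) :
    type_of% stub_unramifiedOutsideP_void := by
  intro F _ _ _ hF p _ ρ hirr hunr hHT hG hE hB _
  exact h F hF p ρ hirr hunr hHT hG hE hB

/-- Composition (no sorry): the ramification lemma closes the unramified-away-from-`p` case. -/
theorem unramifiedOutsideP_void_of_ramified
    (h : type_of% stub_oddGapSum_ramified_away_from_p) :
    type_of% stub_unramifiedOutsideP_void := by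
  intro F _ _ _ hF p _ ρ hirr hunr hHT hG hE hB hU
  exact absurd hU (h F hF p ρ hHT hG hE)

end Summit.Langlands.Langlands.Cruxes.TensorSquareParallel.ParitySketch
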